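import Summits.QuantumFields.BalabanUV.Beta.D1BFx.SectorRecut

/-!
# `BalabanUV.Beta.D1BFx.GaugeJetLocal` — road «BF-x» for binder row D1, leaf A3.a′ (SPLIT-SPEC §4 «(SbR_loc) J5-side check»): THE LOCAL PART OF THE
# GAUGE-TERM JET IS THE ANTISYMMETRISED LONGITUDINAL BLOCK — `dJetSw κ u 1 = DIVₐ κ u` EXACTLY — hence `SbR = DIVₐ + SbRblk` and the re-cut sector is
# `SbRc = (cR + cE)•DIVₐ + cR•SbRblk`: the Feynman completion of the re-cut is exact iff the weights satisfy `cR + cE = 0`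

HONEST DEPENDENCY (page 1, mandatory): continuum YM on T⁴ ⇐ BetaPertH ∧ nine spine estimates (0/9 proved); BetaPertH ⇐ (D1) ∧ (D4) ∧
CAP+tail; G-an2-4 gates asym, D1 and NE2/3/4.  HONEST FRAMING (cell contract, verbatim): «discharging `BetaPertH` makes Bałaban's UV
stability UNCONDITIONAL — a real constructive-QFT result; it is NOT the continuum limit and NOT the Clay problem.»  THIS MODULE DISCHARGES
NOTHING of the wall: two definitions with bodies ([our objects] `idK1` — the identity site kernel — and `SbRblk` — the gauge-term jet MINUS its
local longitudinal part: `dSw (Ṙ κ u) − dJetSw κ u (Pgt n a)`, the projector-dependent words) and [folklore] FINITE bookkeeping over landed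
objects BY NAME: leaf-05-g3's `RJetAssembly.dJetSw`∕`dSw`∕`RjetOf` closed forms (p212431), leaf-07/09's `RJetProjector.Rgt`∕`Rjet`∕`Pgt`, an3's
list `WilsonStencilZ4.divStn` and leaf-03-g4's `CrossERestLists.div₀`∕`realK_reix_div₀`, the owner's `SectorRecut.divK`∕`SbRc`.  No `Prop` is minted,
nothing is cited, no hypothesis is a printed statement, 0 sorry.  0 wall binders instantiated; NOT an A3.a′ BOUND, NOT (K), NOT D1, NOT `BetaPertH`,
NOT continuum, NOT Clay.

ABSOLUTE RULE (cell charter, verbatim): «No internally-minted statement may enter as a cited fact. Every hypothesis is either kernel-proved in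
this package or a verbatim quotation of a PUBLISHED theorem with page reference. The manuscript(s) under audit are NOT citable for their own
disputed steps — they are the thing under adjudication; programme-internal (2001/route/tribunal) claims are never citable.»

WHY (owner d1-p2 gen 3; SPLIT-SPEC v1.1 §3 `SbR_loc := −(cE/cR)•DIVₐ` (a DEFINITION whose correctness «is tested only by the REST bound on `SbR_blk`»)
and §4 «(SbR_loc) J5-side check … the R-jet's LOCAL part equals −(cE/cR)•DIVₐ up to a block-structured kernel … If this FAILS, τ5 carries a log
and the road bends»; the RE-CUT of `SectorRecut`∕`SplitRecut`∕`RoadEndBFxRecut` (p223770∕p223937∕p224363) makes the per-word (REST′) hypotheses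
of the END of record satisfiable ONLY IF the Feynman-completed sector `SbRc := cR•SbR + cE•DIVₐ` has no local longitudinal part).  This file
PERFORMS the J5-side check as a kernel identity.  The gauge-term sector is `SbR n a cK cQ = Rjet n a Ṙ = RjetOf (Rgt n a) Ṙ κ u = dJetSw κ u (1 − Pgt)
+ dSw (Ṙ κ u)` (leaf-05-g3's three-term Leibniz expansion of `∂(D_U R_U D_U*)` at `U = 1`, colour insertion read on the column field), and
`dJetSw κ u` is additive in the site kernel; its value on the IDENTITY site kernel — the jet of the plain longitudinal operator `D_U D_U*` — is
computed here IN CLOSED FORM and found EQUAL to the antisymmetrised longitudinal block `DIVₐ κ u = divK κ u` of the Wilson fine stencil (an3's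
`divStn` realised minus its transpose), entry by entry, with coefficient `+1`.  CONSEQUENCE (displayed, decided by nobody here): in the road's
sign conventions the longitudinal words cancel between the E- and R-sectors iff `cR + cE = 0` (`SbRc_eq`, `SbRc_of_weights`); for any other weight
pair the re-cut sector `SbRc` keeps the local longitudinal block with coefficient `cR + cE` and the (REST′) words `SbT×SbRc`, `SbRc×SbRc` of the END
of record carry the longitudinal `log n` again (FINDING «D1-BFx-LON-MISCUT»).  Whether Bałaban's ∕ the wall literal's weights satisfy
`cR + cE = 0` is a CHECK-N0 (units∕signs) item for the (K) slot — recorded, not asserted.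

CONTENT.
* §1 [our object] `idK1`; [folklore] `dJetSw_sub` (additivity of leaf-05-g3's closed form), `Rgt_eq_idK1_sub`.
* §2 [folklore] the realised longitudinal lists in CLOSED FORM: `divTerm_eq` (the two located pairs of one `divTerm`), `realK_reix_divTerm`,
  **`realK_reix_divStn`** (`= [x = u][α = κ]·([z = u+e_κ] − [z = u+e_κ−e_β])` — «row bond `(u,κ)` ⊗ the divergence at its far endpoint»).
* §3 [folklore] **`dJetSw_idK1_eq_divK : dJetSw κ u idK1 = divK κ u`** — THE J5-SIDE CHECK.
* §4 [our object] `SbRblk`; [folklore] **`SbR_eq_divK_add`** (`SbR = divK + SbRblk`), **`SbRc_eq`** (`SbRc = (cR + cE)•divK + cR•SbRblk`),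
  `SbRc_of_weights` (`cR + cE = 0 ⇒ SbRc = cR•SbRblk`).
Unit `b2b-balaban-beta-d1-p2` (road owner, gen 3); `LEAVES-BFx.md` rows A3.a′ ∕ (K) CHECK-N0; SPLIT-SPEC §4 (SbR_loc).
-/

noncomputable section

namespace Summit.QuantumFields.BalabanUV.Beta.D1BFx.GaugeJetLocal

open Finset
open scoped BigOperators
open Literature.MathematicalPhysics.QuantumFieldTheory.Balaban1983to89
open Literature.MathematicalPhysics.QuantumFieldTheory.Balaban1983to89.Beta
open ExpKernelCalculus (Site MKer)
open DyadicShell (Pt)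
open BubbleTransfer (unitVec)
open GradedBubbles (LP Stn smulS colSh colDiff)
open PlaquetteStencil (dirBlock)
open Summit.QuantumFields.BalabanUV.Beta.WilsonStencilZ4 (divStn divTerm pt)
open Summit.QuantumFields.BalabanUV.Beta.D1BFx.FiniteStencilCalculus (elemK elemK_apply)
open Summit.QuantumFields.BalabanUV.Beta.D1BFx.StencilRealisation (realK realK_nil realK_cons)
open Summit.QuantumFields.BalabanUV.Beta.D1BFx.WilsonStencilRealised (reixStn trStn ιU realK_trStn realK_reixStn realK_append)
open Summit.QuantumFields.BalabanUV.Beta.D1BFx.ColourlessAntisymmetry (reixStn_append)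
open Summit.QuantumFields.BalabanUV.Beta.D1BFx.CrossERestLists (div₀ realK_reix_div₀)
open Summit.QuantumFields.BalabanUV.Beta.D1BFx.ReducedKernel (StencilR)
open Summit.QuantumFields.BalabanUV.Beta.D1BFx.RProjector (Pgt)
open Summit.QuantumFields.BalabanUV.Beta.D1BFx.RProjectorJet (Rdot)
open Summit.QuantumFields.BalabanUV.Beta.D1BFx.RJetAssembly (dSw dJetSw dJetSw_apply RjetOf RjetOf_apply)
open Summit.QuantumFields.BalabanUV.Beta.D1BFx.RJetProjector (Rgt Rgt_apply Rjet Rjet_eq)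
open Summit.QuantumFields.BalabanUV.Beta.D1BFx.GluonKernelSectors (SbR)
open Summit.QuantumFields.BalabanUV.Beta.D1BFx.SectorRecut (divK SbRc SbRc_apply)

/-! ## §1 The identity site kernel; additivity of the `Ḋ`-terms -/

/-- [our object] THE IDENTITY SITE KERNEL on `ℤ⁴` (fibre `Unit`): `idK1 x y = [x = y]`.  A DEFINITION; asserts nothing. -/
def idK1 : MKer 4 Unit := fun x y _ _ => if x = y then 1 else 0

/-- [our object] Unfolding. -/
theorem idK1_apply (x y : Site 4) (a b : Unit) : idK1 x y a b = if x = y then 1 else 0 := rfl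

variable (κ : Fin 4) (u : Site 4)

/-- [folklore] Leaf-05-g3's `Ḋ`-terms are ADDITIVE in the site kernel (closed form): `dJetSw κ u (Y₁ − Y₂) = dJetSw κ u Y₁ − dJetSw κ u Y₂`. -/
theorem dJetSw_sub (Y₁ Y₂ : MKer 4 Unit) : dJetSw κ u (Y₁ - Y₂) = dJetSw κ u Y₁ - dJetSw κ u Y₂ := by
  funext x z α β
  simp only [dJetSw_apply, Pi.sub_apply]
  split_ifs <;> ring

/-- [folklore] The projector complement of J5.0 IS `idK1 − Pgt n a` as a kernel (`RJetProjector.Rgt_apply`). -/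
theorem Rgt_eq_idK1_sub (n : ℕ) (a : ℝ) : Rgt n a = idK1 - Pgt n a := by
  funext x y v w
  rw [Rgt_apply, Pi.sub_apply, Pi.sub_apply, Pi.sub_apply, Pi.sub_apply, idK1_apply]

/-! ## §2 The realised longitudinal lists in closed form -/

section Lists

variable {C : Type*} [Fintype C] [DecidableEq C]

omit [Fintype C] [DecidableEq C] in
/-- [folklore] ONE LONGITUDINAL TERM IS TWO LOCATED PAIRS (an3's `divTerm γ M μ = (−1)•σ_{e_γ}(σ_{−e_μ} − 1)(pt (M ⊗ e_{γμ}))`, by `rfl`):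
row at `0`, columns at `e_γ − e_μ` (matrix `−(M ⊗ e_{γμ})`) and at `e_γ` (matrix `+(M ⊗ e_{γμ})`). -/
theorem divTerm_eq (γ μ : Fin 4) (M : Matrix C C ℝ) :
    divTerm γ M μ = [⟨0, 0 + -unitVec μ + unitVec γ, (-1 : ℝ) • dirBlock γ μ M⟩, ⟨0, 0 + unitVec γ, (-1 : ℝ) • ((-1 : ℝ) • dirBlock γ μ M)⟩] := rfl

/-- [folklore] **ONE REALISED LONGITUDINAL TERM IN CLOSED FORM** (colourless instance, re-indexed along `ιU`):
`realK u u (reixStn ιU (divTerm κ 1 μ)) x z α β = [x = u][α = κ][β = μ]·([z = u + e_κ] − [z = u + e_κ − e_μ])`. -/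
theorem realK_reix_divTerm (μ : Fin 4) (x z : Site 4) (α β : Fin 4) :
    realK u u (reixStn ιU (divTerm κ (1 : Matrix Unit Unit ℝ) μ)) x z α β =
      if x = u ∧ α = κ ∧ β = μ then
        ((if z = u + unitVec κ then (1 : ℝ) else 0) - (if z = u + unitVec κ - unitVec μ then (1 : ℝ) else 0))
      else 0 := by
  rw [realK_reixStn, divTerm_eq]
  simp only [realK_cons, realK_nil, Pi.add_apply, elemK_apply, add_zero, zero_add, dirBlock, Matrix.smul_apply,
    Matrix.of_apply, smul_eq_mul, Matrix.one_apply_eq]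
  have e1 : u + (-unitVec μ + unitVec κ) = u + unitVec κ - unitVec μ := by abel
  rw [e1]
  by_cases hx : x = u
  · by_cases hα : α = κ
    · by_cases hβ : β = μ
      · simp only [hx, hα, hβ, true_and, and_self, if_true]
        split_ifs <;> norm_num
      · simp [hx, hα, hβ]
    · simp [hx, hα]
  · simp [hx]

/-- [folklore] **THE REALISED LONGITUDINAL STENCIL IN CLOSED FORM**: `realK u u (reixStn ιU (divStn κ 1)) x z α β = [x = u][α = κ]·([z = u + e_κ] − [z = u + e_κ − e_β])`
— the row bond `(u, κ)` against the (backward) divergence of the column field at the bond's far endpoint `u + e_κ`. -/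
theorem realK_reix_divStn (x z : Site 4) (α β : Fin 4) :
    realK u u (reixStn ιU (divStn κ (1 : Matrix Unit Unit ℝ))) x z α β =
      if x = u ∧ α = κ then
        ((if z = u + unitVec κ then (1 : ℝ) else 0) - (if z = u + unitVec κ - unitVec β then (1 : ℝ) else 0))
      else 0 := by
  rw [divStn, reixStn_append, reixStn_append, reixStn_append, realK_append, realK_append, realK_append]
  simp only [Pi.add_apply, realK_reix_divTerm]
  by_cases hx : x = u
  · by_cases hα : α = κ
    · simp only [hx, hα, true_and, if_true]
      fin_cases β <;> simp
    · simp [hα]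
  · simp [hx]

end Lists

/-! ## §3 THE J5-SIDE CHECK: the jet of the plain longitudinal operator is the antisymmetrised longitudinal block -/

/-- [folklore] **`dJetSw κ u idK1 = divK κ u`** — the `Ḋ`-terms of the jet of `D_U ∘ 1 ∘ D_U*` at `U = 1` along the fine bond `⟨u, u + e_κ⟩`
(leaf-05-g3's convention: colour insertion on the column field) ARE the antisymmetrised longitudinal block `DIVₐ κ u` of the Wilson fine stencil
(an3's `divStn κ 1` realised at the bond minus its transpose: leaf-03-g4's `div₀`, the owner's `divK`), ENTRY BY ENTRY, coefficient `+1`. -/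
theorem dJetSw_idK1_eq_divK : dJetSw κ u idK1 = divK κ u := by
  funext x z α β
  have hR : divK κ u x z α β = realK u u (reixStn ιU (divStn κ (1 : Matrix Unit Unit ℝ))) x z α β
      - realK u u (reixStn ιU (divStn κ (1 : Matrix Unit Unit ℝ))) z x β α := by
    show realK u u (reixStn ιU (div₀ κ)) x z α β = _
    rw [realK_reix_div₀, Pi.sub_apply, Pi.sub_apply, Pi.sub_apply, Pi.sub_apply, realK_trStn]
  rw [hR, realK_reix_divStn, realK_reix_divStn, dJetSw_apply, idK1_apply, idK1_apply, idK1_apply, idK1_apply]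
  have hu : ∀ ρ : Fin 4, (AffineAveraging.unitVec ρ : Site 4) = unitVec ρ := fun _ => rfl
  simp only [hu]
  have e1 : (x + unitVec α = u + unitVec κ) ↔ (x = u + unitVec κ - unitVec α) := eq_sub_iff_add_eq.symm
  have e2 : (u + unitVec κ = z + unitVec β) ↔ (z = u + unitVec κ - unitVec β) := by
    rw [eq_sub_iff_add_eq]; exact eq_comm
  have e3 : (u + unitVec κ = z) ↔ (z = u + unitVec κ) := eq_comm
  simp only [e1, e2, e3]
  split_ifs <;> ring

/-! ## §4 The gauge-term sector = DIVₐ + the projector words; the re-cut sector's longitudinal coefficient is `cR + cE` -/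

section Sector

variable (n : ℕ) [NeZero n] (a cE cR cK cQ : ℝ)

/-- [our object] **THE GAUGE-TERM JET MINUS ITS LOCAL LONGITUDINAL PART** — the projector-dependent words of J5's three-term expansion:
`SbRblk n a cK cQ κ u := dSw (Ṙ κ u) − dJetSw κ u (Pgt n a)` (`Ṙ = Rdot n a cK cQ`).  By `SbR_eq_divK_add` this IS `SbR − DIVₐ`; it is the honest
object of leaves A3.a′∕A3.b′ (expected block class).  A DEFINITION; asserts nothing about its size. -/
def SbRblk (n : ℕ) [NeZero n] (a cK cQ : ℝ) : StencilR := fun κ u => dSw (Rdot n a cK cQ κ u) - dJetSw κ u (Pgt n a)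

/-- [our object] Unfolding. -/
theorem SbRblk_apply : SbRblk n a cK cQ κ u = dSw (Rdot n a cK cQ κ u) - dJetSw κ u (Pgt n a) := rfl

/-- [folklore] **THE GAUGE-TERM SECTOR IS THE LONGITUDINAL BLOCK PLUS THE PROJECTOR WORDS**: `SbR n a cK cQ κ u = divK κ u + SbRblk n a cK cQ κ u`. -/
theorem SbR_eq_divK_add : SbR n a cK cQ κ u = divK κ u + SbRblk n a cK cQ κ u := by
  show Rjet n a (Rdot n a cK cQ) κ u = _
  rw [Rjet_eq, SbRblk_apply]
  show dJetSw κ u (Rgt n a) + dSw (Rdot n a cK cQ κ u) = _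
  rw [Rgt_eq_idK1_sub, dJetSw_sub, dJetSw_idK1_eq_divK]
  abel

/-- [folklore] **THE RE-CUT GAUGE-TERM SECTOR'S LONGITUDINAL COEFFICIENT IS `cR + cE`**:
`SbRc n a cE cR cK cQ κ u = (cR + cE) • divK κ u + cR • SbRblk n a cK cQ κ u`. -/
theorem SbRc_eq : SbRc n a cE cR cK cQ κ u = (cR + cE) • divK κ u + cR • SbRblk n a cK cQ κ u := by
  rw [SbRc_apply, SbR_eq_divK_add, smul_add, add_smul]
  abel

/-- [folklore] **THE FEYNMAN COMPLETION OF THE RE-CUT IS EXACT IFF `cR + cE = 0`** (sufficiency): then `SbRc = cR • SbRblk` — no longitudinal word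
survives in any re-cut sector. -/
theorem SbRc_of_weights (h : cR + cE = 0) : SbRc n a cE cR cK cQ κ u = cR • SbRblk n a cK cQ κ u := by
  rw [SbRc_eq, h, zero_smul, zero_add]

end Sector

end Summit.QuantumFields.BalabanUV.Beta.D1BFx.GaugeJetLocal

end
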